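import Summits.QuantumFields.BalabanUV.T4Continuum.Support.AveragingDeficitDerivCore

/-!
# AveragingDeficitPeriodicCounting (T⁴ programme, node NE3, row NE3-R2, gen 2) — TORUS BOOKKEEPING FOR THE PERIODIC
# DERIVATIVE WALL β-per: periodic directions, periodicity of the local functionals, torus double counting, the summed
# local right-hand sides of `CoarseCore` against the wall functionals on ONE FUNDAMENTAL DOMAIN, and the exact `L²`-fold
# covering of the fine main term on the torus (file 1/2; file 2/2 `AveragingDeficitDerivWallPeriodic` proves β-per)

HONEST FRAMING (cell `pub-balaban`, T4-DAG PAGE 1; unit `b2b-balaban-t4-ne3r2-p1` = owner of BINDER-OWNERS row NE3-R2,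
gen 2).  The cell's T4 target is the finite-torus continuum limit of the unit-scale averaged loop expectations — NOT
infinite volume, NO mass gap, NOT Clay, NOT summit progress.  Session 1 of this unit PROVED the derivative wall
β = `T4AveragingDeficitWall.DeficitDerivWall` (`AveragingDeficitDerivWallProof.deficitDerivWall_holds`, GAPS G-ne3p2-1):
a statement on `ℤ^d` for FINITELY SUPPORTED directions `ψ` and all sufficiently large windows.  The consumer of β on the
NE3 energy route lives on a finite torus («the consumer periodises», header of `T4AveragingDeficitWall`): its tangent
directions are PERIODIC fields, not finitely supported ones, and its deficit is the full-period-window deficit of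
`T4AveragingDeficitWallBoundary.DeficitValueWallPer`.  Periodising β by cutting a periodic `ψ` off to a fundamental domain
loses the curl form of the wall (the dressed curl of the cut-off field is a partial curl along the cut, controlled by
`‖ψ‖` and not by `‖d_Vψ‖`).  The curl form survives on the torus because the unit's PER-PLAQUETTE core estimate
`AveragingDeficitDerivCore.CoarseCore` (discharged: `AveragingDeficitDerivWallProof.coarseCore_holds`) carries NO support
hypothesis on `ψ`: the torus wall is the SAME core summed with TORUS counting instead of `ℤ^d` counting.  THIS FILE is
that counting (all [folklore] bookkeeping, 0 sorry): §1 periodic directions `IsPeriodicDir` and the periodicity of the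
fine plaquette variable, the flux, the dressed curl and the covariant flux gradient of periodic data (from the tree's
`T4AveragingDeficitNonAbelian.hol_add_period`); §2 torus double counting — `Σ_{y∈[0,M)^d} g(Ly + u) ≤ Σ_{[0,LM)^d} g`
for periodic `g ≥ 0` (the `M^d` sites `Ly + u` are pairwise inequivalent mod `LM`: they are among the block sites, and
the tree's `sum_blocks_eq` + `blockSites_periodBox` + `sum_periodBox_shift` fold the block sites onto the fundamental
domain), hence box sums with multiplicity `(2R_b+1)^d`; §3 the three dominations (S1p)–(S3p) of the summed local
right-hand sides of `CoarseCore` by `dirL1`, `curlL1`, `curlSq`, `gradFluxSq` on the fundamental domain `[0,LM)^d`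
(stencil sums are EXACT `L²`-fold coverings on the torus: tree `sum_periodBox_stencilIdx`); §4 the exact cancellation
identity `Σ_{P} stencilPair = L²·Σ_{p} Re tr((d_Vψ)(p)F(p))` over one period.  NE3 ITSELF IS NOT PROVED by anything here
(energy route: NE3(A) ⇐ ML ∧ R0 ∧ β ∧ γ, record `t4/T4-EST-NE3-P2.md` §0 (e)); NE3 stays COND-free.
CITATION HEADER: no printed sentence is a hypothesis; the manuscripts under audit are not cited for any disputed step;
context: T. Bałaban, Commun. Math. Phys. **98** (1985) 17–51 [Balaban1985Averaging] ((9) p. 18, (42) p. 23, (44) p. 24),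
**95** (1984) 17–40 [Balaban1984PropagatorsI] ((1.6) p. 18 blocks).  PLACEMENT: `Summits/QuantumFields/BalabanUV/`
(human rule 2026-08-19).  Record: HOME `t4/T4-EST-NE3-R2.md` v0.3.
-/

set_option autoImplicit false

open scoped BigOperators Matrix Matrix.Norms.L2Operator Topology
open NormedSpace Finset Filter

namespace Summit.QuantumFields.BalabanUV.T4Continuum.AveragingDeficitPeriodicCounting

open Literature.MathematicalPhysics.QuantumFieldTheory.Balaban1983to89
open B7Prop1Explicit B7Prop2Explicit MatrixLog UnitaryModel
open T4AveragingDeficitWall hiding Site Plane Plaq Bond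
open T4AveragingDeficitWallBoundary (stencilIdx stencilOff card_stencilIdx IsPeriodicCfg periodBox blockSites_periodBox
  sum_blocks_eq sum_periodBox_shift sum_periodBox_stencilIdx card_periodBox)
open T4AveragingDeficitNonAbelian (hol_add_period)
open AveragingDeficitCounting AveragingDeficitDerivCore

noncomputable section

variable {d : ℕ} {n : Type*} [Fintype n] [DecidableEq n]

local notation "𝕄" => Matrix n n ℂ
local notation "Site" => B7Prop1Explicit.Site
local notation "Plane" => T4AveragingDeficitWall.Plane
local notation "Plaq" => T4AveragingDeficitWall.Plaq

/-! ## §1 Periodic directions; periodicity of the local functionals of periodic data -/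

/-- Periodicity of a direction field with period `P` in every coordinate direction (a tangent field on the torus
`(ℤ/Pℤ)^d` read on its universal cover; companion of `IsPeriodicCfg`). [folklore] -/
def IsPeriodicDir (ψ : Site d → Fin d → 𝕄) (P : ℤ) : Prop :=
  ∀ (x : Site d) (κ μ : Fin d), ψ (x + P • e κ) μ = ψ x μ

omit [Fintype n] [DecidableEq n] in
/-- The zero direction is periodic with every period. [folklore] -/
theorem isPeriodicDir_zero (P : ℤ) : IsPeriodicDir (fun (_ : Site d) (_ : Fin d) => (0 : 𝕄)) P := fun _ _ _ => rfl

/-- The fine plaquette variable of a periodic configuration is periodic in the corner. [cite: Balaban1985Averaging, (9) p.18, (44) p.24] -/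
theorem fhol_add_period {V : Site d → Fin d → 𝕄ˣ} {P : ℤ} (hV : IsPeriodicCfg V P) (x : Site d) (κ : Fin d)
    (π : Plane d) : fhol V (x + P • e κ, π) = fhol V (x, π) :=
  hol_add_period hV κ _ _

/-- The flux of a periodic configuration is periodic. [folklore] -/
theorem flux_add_period {V : Site d → Fin d → 𝕄ˣ} {P : ℤ} (hV : IsPeriodicCfg V P) (x : Site d) (κ : Fin d)
    (π : Plane d) : flux V (x + P • e κ, π) = flux V (x, π) := by
  unfold flux
  rw [fhol_add_period hV]

/-- The dressed curl of periodic data is periodic. [folklore] -/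
theorem curl_add_period {V : Site d → Fin d → 𝕄ˣ} {ψ : Site d → Fin d → 𝕄} {P : ℤ} (hV : IsPeriodicCfg V P)
    (hψ : IsPeriodicDir ψ P) (x : Site d) (κ : Fin d) (π : Plane d) :
    curl V ψ (x + P • e κ, π) = curl V ψ (x, π) := by
  simp only [curl, curlAt, add_right_comm _ (P • e κ), hV _ κ, hψ _ κ]

/-- The covariant flux gradient of a periodic configuration is periodic. [folklore] -/
theorem covGrad_flux_add_period {V : Site d → Fin d → 𝕄ˣ} {P : ℤ} (hV : IsPeriodicCfg V P) (x : Site d)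
    (κ κ' : Fin d) (π : Plane d) : covGrad V (flux V) (x + P • e κ) κ' π = covGrad V (flux V) x κ' π := by
  unfold covGrad
  rw [add_right_comm _ (P • e κ), flux_add_period hV, flux_add_period hV, hV _ κ]

omit [Fintype n] [DecidableEq n] in
/-- The period `L·M` as an integer: `((L·M : ℕ) : ℤ) = L·M`. [folklore] -/
theorem natCast_mul_period (L M : ℕ) : (((L * M : ℕ) : ℤ)) = (L : ℤ) * M := by push_cast; ring

/-! ## §2 Torus double counting -/

omit [Fintype n] [DecidableEq n] in
/-- A box is the translate of the centred box. [folklore] -/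
theorem box_eq_image_add (R : ℕ) (c : Site d) : box R c = (box R 0).image (fun v => c + v) := by
  ext x
  simp only [Finset.mem_image, mem_box_iff]
  constructor
  · intro h
    refine ⟨x - c, fun κ => ?_, by abel⟩
    simpa using h κ
  · rintro ⟨v, hv, rfl⟩ κ
    simpa using hv κ

omit [Fintype n] [DecidableEq n] in
/-- Box sums as sums over the centred box. [folklore] -/
theorem sum_box_eq_sum_add (R : ℕ) (c : Site d) (g : Site d → ℝ) :
    ∑ x ∈ box R c, g x = ∑ v ∈ box R 0, g (c + v) := by
  rw [box_eq_image_add, Finset.sum_image fun v _ v' _ h => add_left_cancel h]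

omit [Fintype n] [DecidableEq n] in
/-- **TORUS COUNTING**: for an `LM`-periodic `g ≥ 0` and any offset `u`, `Σ_{y∈[0,M)^d} g(Ly + u) ≤ Σ_{x∈[0,LM)^d} g(x)`
(the `M^d` sites `Ly + u` are block sites `Ly + r + u` with `r = 0`; all block sites of `[0,M)^d` shifted by `u` fold
bijectively onto the fundamental domain). [folklore] -/
theorem sum_periodBox_smul_add_le (L M : ℕ) (hL : 1 ≤ L) (hM : 1 ≤ M) {g : Site d → ℝ} (hg0 : ∀ x, 0 ≤ g x)
    (hg : ∀ (x : Site d) (κ : Fin d), g (x + ((L * M : ℕ) : ℤ) • e κ) = g x) (u : Site d) :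
    ∑ y ∈ periodBox M, g ((L : ℤ) • y + u) ≤ ∑ x ∈ periodBox (L * M), g x := by
  have hLM : 1 ≤ L * M := Nat.one_le_iff_ne_zero.mpr (Nat.mul_ne_zero (by omega) (by omega))
  let r₀ : Fin d → Fin L := fun _ => ⟨0, hL⟩
  have hr₀ : boxVec L r₀ = 0 := by funext κ; simp [boxVec, r₀]
  calc ∑ y ∈ periodBox M, g ((L : ℤ) • y + u)
      = ∑ y ∈ periodBox M, g ((L : ℤ) • y + boxVec L r₀ + u) := by simp only [hr₀, add_zero]
    _ ≤ ∑ y ∈ periodBox M, ∑ r : Fin d → Fin L, g ((L : ℤ) • y + boxVec L r + u) :=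
        Finset.sum_le_sum fun y _ =>
          Finset.single_le_sum (f := fun r : Fin d → Fin L => g ((L : ℤ) • y + boxVec L r + u))
            (fun _ _ => hg0 _) (Finset.mem_univ r₀)
    _ = ∑ x ∈ periodBox (L * M), g (x + u) := by
        rw [sum_blocks_eq L hL (periodBox M) (fun x => g (x + u)), blockSites_periodBox L M hL]
    _ = ∑ x ∈ periodBox (L * M), g x := sum_periodBox_shift (L * M) hLM hg u

omit [Fintype n] [DecidableEq n] in
/-- **TORUS DOUBLE COUNTING OF BOX SUMS**: for an `LM`-periodic `g ≥ 0`,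
`Σ_{y∈[0,M)^d} Σ_{x∈box R (Ly)} g(x) ≤ (2R+1)^d · Σ_{x∈[0,LM)^d} g(x)`. [folklore] -/
theorem sum_periodBox_box_le (L M : ℕ) (hL : 1 ≤ L) (hM : 1 ≤ M) (R : ℕ) {g : Site d → ℝ} (hg0 : ∀ x, 0 ≤ g x)
    (hg : ∀ (x : Site d) (κ : Fin d), g (x + ((L * M : ℕ) : ℤ) • e κ) = g x) :
    ∑ y ∈ periodBox M, ∑ x ∈ box R ((L : ℤ) • y), g x ≤ (2 * R + 1) ^ d * ∑ x ∈ periodBox (L * M), g x := by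
  calc ∑ y ∈ periodBox M, ∑ x ∈ box R ((L : ℤ) • y), g x
      = ∑ y ∈ periodBox M, ∑ v ∈ box R 0, g ((L : ℤ) • y + v) :=
        Finset.sum_congr rfl fun y _ => sum_box_eq_sum_add R _ g
    _ = ∑ v ∈ box R 0, ∑ y ∈ periodBox M, g ((L : ℤ) • y + v) := Finset.sum_comm
    _ ≤ ∑ _v ∈ box R (0 : Site d), ∑ x ∈ periodBox (L * M), g x :=
        Finset.sum_le_sum fun v _ => sum_periodBox_smul_add_le L M hL hM hg0 hg v
    _ = (2 * R + 1) ^ d * ∑ x ∈ periodBox (L * M), g x := by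
        rw [Finset.sum_const, card_box_eq, nsmul_eq_mul]; push_cast; ring

/-! ## §3 The summed local right-hand sides of `CoarseCore` on the torus, against the wall functionals on `[0,LM)^d` -/

/-- **(S1p)** `Σ_{y∈[0,M)^d} Σ_π ‖ψ‖_{ℓ¹(box R_b (Ly))} ≤ #Plane·(2R_b+1)^d · ‖ψ‖_{ℓ¹([0,LM)^d)}` for periodic `ψ`. [folklore] -/
theorem sum_dirL1_box_le_per (L M : ℕ) (hL : 1 ≤ L) (hM : 1 ≤ M) (Rb : ℕ) {ψ : Site d → Fin d → 𝕄}
    (hψ : IsPeriodicDir ψ ((L : ℤ) * M)) :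
    ∑ y ∈ periodBox M, ∑ _π : Plane d, dirL1 ψ (box Rb ((L : ℤ) • y))
      ≤ (Fintype.card (Plane d)) * (2 * Rb + 1) ^ d * dirL1 ψ (periodBox (L * M)) := by
  simp only [Finset.sum_const, Finset.card_univ, nsmul_eq_mul, ← Finset.mul_sum]
  rw [mul_assoc]
  refine mul_le_mul_of_nonneg_left ?_ (Nat.cast_nonneg _)
  unfold T4AveragingDeficitWall.dirL1
  refine sum_periodBox_box_le L M hL hM Rb (fun _ => Finset.sum_nonneg fun _ _ => norm_nonneg _) fun x κ => ?_
  rw [natCast_mul_period]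
  exact Finset.sum_congr rfl fun μ _ => by rw [hψ x κ μ]

/-- **(S2p)** `Σ_{y∈[0,M)^d} Σ_π stencilCurlL1 = L² · ‖d_Vψ‖_{ℓ¹([0,LM)^d)}` (EXACT on the torus) for periodic data. [folklore] -/
theorem sum_stencilCurlL1_eq_per (L M : ℕ) (hL : 1 ≤ L) (hM : 1 ≤ M) {V : Site d → Fin d → 𝕄ˣ}
    {ψ : Site d → Fin d → 𝕄} (hV : IsPeriodicCfg V ((L : ℤ) * M)) (hψ : IsPeriodicDir ψ ((L : ℤ) * M)) :
    ∑ y ∈ periodBox M, ∑ π : Plane d, stencilCurlL1 L V ψ y π = (L : ℝ) ^ 2 * curlL1 V ψ (periodBox (L * M)) := by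
  calc ∑ y ∈ periodBox M, ∑ π : Plane d, stencilCurlL1 L V ψ y π
      = ∑ π : Plane d, ∑ y ∈ periodBox M, stencilCurlL1 L V ψ y π := Finset.sum_comm
    _ = ∑ π : Plane d, (L : ℝ) ^ 2 * ∑ x ∈ periodBox (L * M), ‖curl V ψ (x, π)‖ :=
        Finset.sum_congr rfl fun π _ =>
          sum_periodBox_stencilIdx L M hL hM (G := fun x => ‖curl V ψ (x, π)‖)
            (fun x κ => by rw [natCast_mul_period, curl_add_period hV hψ]) π.1.1 π.1.2
    _ = (L : ℝ) ^ 2 * curlL1 V ψ (periodBox (L * M)) := by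
        unfold T4AveragingDeficitWall.curlL1
        rw [← Finset.mul_sum, Finset.sum_comm]

/-- `Σ_{y∈[0,M)^d} Σ_π Σ_k ‖(d_Vψ)(p_k)‖² = L² · ‖d_Vψ‖²_{ℓ²([0,LM)^d)}` (EXACT) for periodic data. [folklore] -/
theorem sum_stencilCurlSq_eq_per (L M : ℕ) (hL : 1 ≤ L) (hM : 1 ≤ M) {V : Site d → Fin d → 𝕄ˣ}
    {ψ : Site d → Fin d → 𝕄} (hV : IsPeriodicCfg V ((L : ℤ) * M)) (hψ : IsPeriodicDir ψ ((L : ℤ) * M)) :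
    ∑ y ∈ periodBox M, ∑ π : Plane d, ∑ k ∈ stencilIdx d L, ‖curl V ψ (stencilPlaq L y π k)‖ ^ 2
      = (L : ℝ) ^ 2 * curlSq V ψ (periodBox (L * M)) := by
  calc ∑ y ∈ periodBox M, ∑ π : Plane d, ∑ k ∈ stencilIdx d L, ‖curl V ψ (stencilPlaq L y π k)‖ ^ 2
      = ∑ π : Plane d, ∑ y ∈ periodBox M, ∑ k ∈ stencilIdx d L, ‖curl V ψ (stencilPlaq L y π k)‖ ^ 2 :=
        Finset.sum_comm
    _ = ∑ π : Plane d, (L : ℝ) ^ 2 * ∑ x ∈ periodBox (L * M), ‖curl V ψ (x, π)‖ ^ 2 :=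
        Finset.sum_congr rfl fun π _ =>
          sum_periodBox_stencilIdx L M hL hM (G := fun x => ‖curl V ψ (x, π)‖ ^ 2)
            (fun x κ => by rw [natCast_mul_period, curl_add_period hV hψ]) π.1.1 π.1.2
    _ = (L : ℝ) ^ 2 * curlSq V ψ (periodBox (L * M)) := by
        unfold T4AveragingDeficitWall.curlSq
        rw [← Finset.mul_sum, Finset.sum_comm]

/-- `Σ_{y∈[0,M)^d} Σ_π Σ_{x∈box R_b(Ly)} Σ_κ ‖∇_VF(x,κ;π)‖² ≤ (2R_b+1)^d · ‖∇_VF‖²_{ℓ²([0,LM)^d)}` for periodic `V`. [folklore] -/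
theorem sum_boxGradSq_le_per (L M : ℕ) (hL : 1 ≤ L) (hM : 1 ≤ M) (Rb : ℕ) {V : Site d → Fin d → 𝕄ˣ}
    (hV : IsPeriodicCfg V ((L : ℤ) * M)) :
    ∑ y ∈ periodBox M, ∑ π : Plane d, ∑ x ∈ box Rb ((L : ℤ) • y), ∑ κ : Fin d, ‖covGrad V (flux V) x κ π‖ ^ 2
      ≤ (2 * Rb + 1) ^ d * gradFluxSq V (periodBox (L * M)) := by
  calc ∑ y ∈ periodBox M, ∑ π : Plane d, ∑ x ∈ box Rb ((L : ℤ) • y), ∑ κ : Fin d, ‖covGrad V (flux V) x κ π‖ ^ 2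
      = ∑ π : Plane d, ∑ y ∈ periodBox M, ∑ x ∈ box Rb ((L : ℤ) • y), ∑ κ : Fin d,
          ‖covGrad V (flux V) x κ π‖ ^ 2 := Finset.sum_comm
    _ ≤ ∑ π : Plane d, (2 * Rb + 1) ^ d *
          ∑ x ∈ periodBox (L * M), ∑ κ : Fin d, ‖covGrad V (flux V) x κ π‖ ^ 2 :=
        Finset.sum_le_sum fun π _ =>
          sum_periodBox_box_le L M hL hM Rb (fun _ => Finset.sum_nonneg fun _ _ => sq_nonneg _) fun x κ => by
            rw [natCast_mul_period]
            exact Finset.sum_congr rfl fun κ' _ => by rw [covGrad_flux_add_period hV]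
    _ = (2 * Rb + 1) ^ d * gradFluxSq V (periodBox (L * M)) := by
        unfold T4AveragingDeficitWall.gradFluxSq
        rw [← Finset.mul_sum, Finset.sum_comm]
        congr 1
        exact Finset.sum_congr rfl fun x _ => Finset.sum_comm

/-- **(S3p)** the Cauchy–Schwarz assembly of the main term on the torus:
`Σ_{y∈[0,M)^d} Σ_π stencilCurlL1·boxGradL1 ≤ √(L^{d+4}·‖d_Vψ‖²_{ℓ²}) · √((2R_b+1)^{2d}·d·‖∇_VF‖²_{ℓ²})` on `[0,LM)^d`. [folklore] -/
theorem sum_stencilCurl_mul_boxGrad_le_per (L M : ℕ) (hL : 1 ≤ L) (hM : 1 ≤ M) (Rb : ℕ) {V : Site d → Fin d → 𝕄ˣ}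
    {ψ : Site d → Fin d → 𝕄} (hV : IsPeriodicCfg V ((L : ℤ) * M)) (hψ : IsPeriodicDir ψ ((L : ℤ) * M)) :
    ∑ y ∈ periodBox M, ∑ π : Plane d, stencilCurlL1 L V ψ y π * boxGradL1 L V Rb y π
      ≤ Real.sqrt ((L : ℝ) ^ (d + 4) * curlSq V ψ (periodBox (L * M)))
        * Real.sqrt (((2 * Rb + 1 : ℕ) : ℝ) ^ (2 * d) * d * gradFluxSq V (periodBox (L * M))) := by
  set N := periodBox (d := d) (L * M) with hN
  rw [← Finset.sum_product']
  refine (Real.sum_mul_le_sqrt_mul_sqrt _ _ _).trans ?_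
  refine mul_le_mul (Real.sqrt_le_sqrt ?_) (Real.sqrt_le_sqrt ?_) (Real.sqrt_nonneg _) (Real.sqrt_nonneg _)
  · -- `Σ SG² ≤ L^{d+2} Σ_q Σ_k ‖G_k‖² = L^{d+4} curlSq`
    set U : Site d × Plane d → ℝ := fun q => ∑ k ∈ stencilIdx d L, ‖curl V ψ (stencilPlaq L q.1 q.2 k)‖ ^ 2 with hU
    have h1 : ∀ q : Site d × Plane d, stencilCurlL1 L V ψ q.1 q.2 ^ 2 ≤ (L : ℝ) ^ (d + 2) * U q := by
      intro q
      refine (sq_sum_le_card_mul_sum_sq (s := stencilIdx d L)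
        (f := fun k => ‖curl V ψ (stencilPlaq L q.1 q.2 k)‖)).trans (le_of_eq ?_)
      rw [card_stencilIdx]; push_cast; rfl
    have hUsum : ∑ q ∈ periodBox M ×ˢ (Finset.univ : Finset (Plane d)), U q = (L : ℝ) ^ 2 * curlSq V ψ N := by
      rw [Finset.sum_product]
      exact sum_stencilCurlSq_eq_per L M hL hM hV hψ
    calc ∑ q ∈ periodBox M ×ˢ (Finset.univ : Finset (Plane d)), stencilCurlL1 L V ψ q.1 q.2 ^ 2
        ≤ ∑ q ∈ periodBox M ×ˢ (Finset.univ : Finset (Plane d)), (L : ℝ) ^ (d + 2) * U q :=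
          Finset.sum_le_sum fun q _ => h1 q
      _ = (L : ℝ) ^ (d + 2) * ∑ q ∈ periodBox M ×ˢ (Finset.univ : Finset (Plane d)), U q := by
          rw [Finset.mul_sum]
      _ = (L : ℝ) ^ (d + 2) * ((L : ℝ) ^ 2 * curlSq V ψ N) := by rw [hUsum]
      _ = (L : ℝ) ^ (d + 4) * curlSq V ψ N := by ring
  · -- `Σ SF² ≤ (2Rb+1)^d · d · Σ_q T q ≤ (2Rb+1)^{2d} d gradFluxSq`
    set T : Site d × Plane d → ℝ := fun q =>
      ∑ x ∈ box Rb ((L : ℤ) • q.1), ∑ κ : Fin d, ‖covGrad V (flux V) x κ q.2‖ ^ 2 with hT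
    have h1 : ∀ q : Site d × Plane d, boxGradL1 L V Rb q.1 q.2 ^ 2 ≤ ((2 * Rb + 1 : ℕ) : ℝ) ^ d * ((d : ℝ) * T q) := by
      intro q
      refine (sq_sum_le_card_mul_sum_sq (s := box Rb ((L : ℤ) • q.1))
        (f := fun x => ∑ κ : Fin d, ‖covGrad V (flux V) x κ q.2‖)).trans ?_
      rw [card_box_eq]
      push_cast
      refine mul_le_mul_of_nonneg_left ?_ (by positivity)
      rw [hT, Finset.mul_sum]
      refine Finset.sum_le_sum fun x _ => ?_
      refine (sq_sum_le_card_mul_sum_sq (s := (Finset.univ : Finset (Fin d)))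
        (f := fun κ => ‖covGrad V (flux V) x κ q.2‖)).trans (le_of_eq ?_)
      rw [Finset.card_univ, Fintype.card_fin]
    have hTsum : ∑ q ∈ periodBox M ×ˢ (Finset.univ : Finset (Plane d)), T q ≤ (2 * Rb + 1) ^ d * gradFluxSq V N := by
      rw [Finset.sum_product]
      exact sum_boxGradSq_le_per L M hL hM Rb hV
    calc ∑ q ∈ periodBox M ×ˢ (Finset.univ : Finset (Plane d)), boxGradL1 L V Rb q.1 q.2 ^ 2
        ≤ ∑ q ∈ periodBox M ×ˢ (Finset.univ : Finset (Plane d)), ((2 * Rb + 1 : ℕ) : ℝ) ^ d * ((d : ℝ) * T q) :=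
          Finset.sum_le_sum fun q _ => h1 q
      _ = ((2 * Rb + 1 : ℕ) : ℝ) ^ d * ((d : ℝ) * ∑ q ∈ periodBox M ×ˢ (Finset.univ : Finset (Plane d)), T q) := by
          rw [Finset.mul_sum, Finset.mul_sum]
      _ ≤ ((2 * Rb + 1 : ℕ) : ℝ) ^ d * ((d : ℝ) * ((2 * Rb + 1) ^ d * gradFluxSq V N)) := by
          refine mul_le_mul_of_nonneg_left (mul_le_mul_of_nonneg_left hTsum (Nat.cast_nonneg d)) (by positivity)
      _ = ((2 * Rb + 1 : ℕ) : ℝ) ^ (2 * d) * d * gradFluxSq V N := by push_cast; ring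

/-! ## §4 The exact `L²`-fold covering of the fine main term on the torus -/

/-- **THE EXACT `L²`-FOLD COVERING ON THE TORUS**: for periodic data,
`Σ_{(y,π) ∈ [0,M)^d × planes} Σ_{k∈stencil} Re tr((d_Vψ)(p_k)F(p_k)) = L² · Σ_{(x,π) ∈ [0,LM)^d × planes} Re tr((d_Vψ)(x;π)F(x;π))`
(every fine plaquette of the torus lies in exactly `L²` stencils). [folklore] -/
theorem sum_stencilPair_eq_per (L M : ℕ) (hL : 1 ≤ L) (hM : 1 ≤ M) {V : Site d → Fin d → 𝕄ˣ}
    {ψ : Site d → Fin d → 𝕄} (hV : IsPeriodicCfg V ((L : ℤ) * M)) (hψ : IsPeriodicDir ψ ((L : ℤ) * M)) :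
    ∑ P ∈ periodBox M ×ˢ (Finset.univ : Finset (Plane d)), stencilPair L V ψ P.1 P.2
      = (L : ℝ) ^ 2 * ∑ p ∈ periodBox (L * M) ×ˢ (Finset.univ : Finset (Plane d)), nReTr (curl V ψ p * flux V p) := by
  rw [Finset.sum_product', Finset.sum_product]
  conv_lhs => rw [Finset.sum_comm]
  conv_rhs => rw [Finset.sum_comm, Finset.mul_sum]
  refine Finset.sum_congr rfl fun π _ => ?_
  unfold stencilPair stencilPlaq
  exact sum_periodBox_stencilIdx L M hL hM (G := fun x => nReTr (curl V ψ (x, π) * flux V (x, π)))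
    (fun x κ => by rw [natCast_mul_period, curl_add_period hV hψ, flux_add_period hV]) π.1.1 π.1.2

end

end Summit.QuantumFields.BalabanUV.T4Continuum.AveragingDeficitPeriodicCounting
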